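import Literature.Geometry.Lorentzian.InverseMeanCurvatureFlowExteriorAssembly
import Literature.Geometry.Lorentzian.InverseMeanCurvatureFlowInitialValue
import Literature.Geometry.Lorentzian.InverseMeanCurvatureFlowLimits
import HarnessLib

/-!
# Inverse mean curvature flow I — proofs: the exterior solution from regularised Dirichlet
# solutions (the limit `L → ∞` in the proof of Thm. 3.1)

Continuation of `InverseMeanCurvatureFlowExteriorAssembly.lean`. Huisken–Ilmanen's proof of the
Weak Existence Theorem 3.1 (J. Differential Geom. 59 (2001), §3, p. 26–27) ends: "`u_L ≥ v` on
`F_L`. Passing `L → ∞` and taking a convergent subsequence via (3.1), the Compactness Theorem 2.1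
yields a solution `u` defined everywhere on `M`, with `u ≥ v`." This file performs that passage
for the level-set formulation of `InverseMeanCurvatureFlow.lean`, starting from the analytic output
of Lemmas 3.4–3.5 for all `L` taken as hypotheses
(`exterior_existence_of_regularised_dirichlet_solutions`): for an exhaustion `U_L` of `X` by open
sets containing `Ē₀` and classical solutions `w_{L,k}` of (⋆)_{ε_{L,k}} on `U_L ∖ Ē₀` with the
estimates of loc. cit. (local gradient bounds, uniform in `k` on `U_L ∖ Ē₀` and uniform in
`(L, k)` eventually near every point of `X ∖ Ē₀`; Lipschitz bounds up to `∂E₀`, `w = 0` on `∂E₀`;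
`w ≥ −η_{L,k}`, `η_{L,k} → 0`; pointwise upper bounds; the lower barrier `w ≥ b_L − δ` off compact
subsets of `U_L`, `b_L → ∞`), there is an *exterior solution* `u₀` in the sense of
`weak_existence_of_exterior_existence` (`InverseMeanCurvatureFlowInitialValue.lean`): locally
Lipschitz on `X ∖ E₀` up to the boundary, `u₀ = 0` on `∂E₀`, `u₀ ≥ 0`, compact exterior sublevel
sets, and (1.5) on `X ∖ Ē₀`. With that reduction and the Uniqueness Theorem, the named fact
`weak_existence` is thereby reduced to the PDE theory of (⋆)_ε alone.

Steps: the fixed-`L` limits `u_L ≥ min(v, b_L)` (`exists_isWeakSolution_ge_of_regularised_dirichlet`);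
equi-Lipschitz bounds for the `u_L`, eventually in `L`, from the uniform gradient bounds
(`exists_nhds_subset_forall_lipschitzOnWith_of_gradNorm_le`, `lipschitzOnWith_of_tendsto`);
Arzelà–Ascoli for eventually equi-Lipschitz sequences
(`exists_strictMono_tendstoLocallyUniformlyOn_of_eventually_lipschitzOnWith`); the exact
Compactness Theorem 2.1 (`isWeakSolution_of_tendstoLocallyUniformlyOn`); `u ≥ v` and properness
(`isCompact_sep_le_of_le`).

Everything is proved; there are no definitions and no named facts.

## References

* G. Huisken, T. Ilmanen, *The inverse mean curvature flow and the Riemannian Penrose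
  inequality*, J. Differential Geom. 59 (2001) 353–437: §3, proof of Thm. 3.1, steps 1–2.
-/

noncomputable section

open Bundle Set Manifold TopologicalSpace Filter MeasureTheory Function
open scoped ContDiff Topology ENNReal NNReal Manifold Real

namespace Literature.Geometry.Lorentzian

open PseudoRiemannianMetric

variable {X : Type*} [TopologicalSpace X] [ChartedSpace E3 X] [IsManifold (𝓡 3) ∞ X]
  (h : ContMDiffRiemannianMetric (𝓡 3) ∞ E3 (TangentSpace (𝓡 3) : X → Type _))
  [T2Space X] [LocallyCompactSpace X] [SecondCountableTopology X]

/-! ### Arzelà–Ascoli for eventually equi-Lipschitz sequences -/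

set_option backward.isDefEq.respectTransparency false in
/-- **Arzelà–Ascoli for eventually locally equi-Lipschitz, pointwise bounded sequences** on an
open subset of a Riemannian manifold (as
`exists_strictMono_tendstoLocallyUniformlyOn_of_lipschitzOnWith`, the Lipschitz bounds near each
point being required only for large indices, the threshold depending on the point). This is the
form needed for the family `(u_L)` of the proof of Thm. 3.1, whose gradient bounds near a point
hold once `L` is large. [cite: HuiskenIlmanenIMCF2001, §3 proof of Thm. 3.1 (Arzelà–Ascoli)] -/
theorem exists_strictMono_tendstoLocallyUniformlyOn_of_eventually_lipschitzOnWith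
    {u : ℕ → X → ℝ} {Ω : Set X}
    (hΩ : IsOpen Ω)
    (hlip : letI : RiemannianBundle (fun x : X ↦ TangentSpace (𝓡 3) x) :=
        ⟨h.toContinuousRiemannianMetric.toRiemannianMetric⟩
      letI : PseudoEMetricSpace X := .ofRiemannianMetric (𝓡 3) X
      ∀ x ∈ Ω, ∃ K : ℝ≥0, ∃ V ∈ 𝓝 x, ∀ᶠ i in atTop, LipschitzOnWith K (u i) V)
    (hbdd : ∀ x ∈ Ω, ∃ B : ℝ, ∀ i, |u i x| ≤ B) :
    ∃ (φ : ℕ → ℕ) (U : X → ℝ), StrictMono φ ∧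
      TendstoLocallyUniformlyOn (fun n ↦ u (φ n)) U atTop Ω := by
  letI : RiemannianBundle (fun x : X ↦ TangentSpace (𝓡 3) x) :=
    ⟨h.toContinuousRiemannianMetric.toRiemannianMetric⟩
  letI : PseudoEMetricSpace X := .ofRiemannianMetric (𝓡 3) X
  -- a countable dense set and the diagonal subsequence converging on it
  obtain ⟨D, hDc, hDd⟩ := TopologicalSpace.exists_countable_dense X
  haveI : Countable (D ∩ Ω : Set X) := (hDc.mono inter_subset_left).to_subtype
  obtain ⟨φ, hφ, hconvD⟩ :=
    Literature.Analysis.FunctionSpaces.exists_strictMono_forall_tendsto_real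
      (fun n (d : (D ∩ Ω : Set X)) ↦ u n d) (fun d ↦ hbdd d d.2.2)
  -- near every point of `Ω`: a Lipschitz neighbourhood and nearby points of `D`
  have hnear : ∀ x ∈ Ω, ∀ {K : ℝ≥0} {V : Set X}, V ∈ 𝓝 x → ∀ {η : ℝ}, 0 < η →
      ∃ d, d ∈ V ∧ d ∈ Ω ∧ d ∈ D ∧ edist x d ≤ ENNReal.ofReal η := by
    intro x hx K V hV η hη
    have hopen : IsOpen (interior V ∩ Ω ∩ Metric.eball x (ENNReal.ofReal η)) :=
      (isOpen_interior.inter hΩ).inter Metric.isOpen_eball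
    have hxmem : x ∈ interior V ∩ Ω ∩ Metric.eball x (ENNReal.ofReal η) :=
      ⟨⟨mem_interior_iff_mem_nhds.2 hV, hx⟩, Metric.mem_eball_self (by simpa using hη)⟩
    obtain ⟨d, hdD, ⟨⟨hdV, hdΩ⟩, hdball⟩⟩ := hDd.exists_mem_open hopen ⟨x, hxmem⟩
    refine ⟨d, interior_subset hdV, hdΩ, hdD, ?_⟩
    rw [edist_comm]; exact (Metric.mem_eball.1 hdball).le
  -- the sequence is Cauchy at every point of `Ω`
  have hcauchy : ∀ x ∈ Ω, CauchySeq (fun n ↦ u (φ n) x) := by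
    intro x hx
    obtain ⟨K, V, hV, hK'⟩ := hlip x hx
    obtain ⟨I, hI⟩ := eventually_atTop.1 hK'
    have hK : ∀ n, I ≤ n → LipschitzOnWith K (u (φ n)) V := fun n hn ↦
      hI (φ n) (hn.trans (hφ.id_le n))
    have hxV : x ∈ V := mem_of_mem_nhds hV
    rw [Metric.cauchySeq_iff]
    intro ε hε
    set η : ℝ := ε / (4 * (K + 1)) with hη
    have hη0 : 0 < η := by positivity
    have hKη : (K : ℝ) * η ≤ ε / 4 := by
      rw [hη, mul_div_assoc', div_le_div_iff₀ (by positivity) (by positivity)]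
      nlinarith [NNReal.coe_nonneg K, hε.le]
    obtain ⟨d, hdV, hdΩ, hdD, hxd⟩ := hnear x hx (K := K) hV hη0
    obtain ⟨l, hl⟩ := hconvD ⟨d, hdD, hdΩ⟩
    obtain ⟨N, hN⟩ := Metric.cauchySeq_iff.1 hl.cauchySeq (ε / 2) (half_pos hε)
    refine ⟨max N I, fun m hm n hn ↦ ?_⟩
    have h1 : |u (φ m) x - u (φ m) d| ≤ K * η :=
      abs_sub_le_of_lipschitzOnWith (hK m (le_of_max_le_right hm)) hxV hdV hη0.le hxd
    have h2 : |u (φ n) x - u (φ n) d| ≤ K * η :=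
      abs_sub_le_of_lipschitzOnWith (hK n (le_of_max_le_right hn)) hxV hdV hη0.le hxd
    have h3 : |u (φ m) d - u (φ n) d| < ε / 2 := by
      have := hN m (le_of_max_le_left hm) n (le_of_max_le_left hn); rwa [Real.dist_eq] at this
    rw [Real.dist_eq]
    calc |u (φ m) x - u (φ n) x|
        ≤ |u (φ m) x - u (φ m) d| + |u (φ m) d - u (φ n) d| + |u (φ n) d - u (φ n) x| := by
          calc |u (φ m) x - u (φ n) x| ≤ |u (φ m) x - u (φ n) d| + |u (φ n) d - u (φ n) x| :=
                abs_sub_le _ _ _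
            _ ≤ |u (φ m) x - u (φ m) d| + |u (φ m) d - u (φ n) d| + |u (φ n) d - u (φ n) x| := by
                gcongr; exact abs_sub_le _ _ _
      _ < ε := by rw [abs_sub_comm (u (φ n) d)]; linarith
  -- the limit function
  have hconv : ∀ x ∈ Ω, ∃ l, Tendsto (fun n ↦ u (φ n) x) atTop (𝓝 l) := fun x hx ↦
    cauchySeq_tendsto_of_complete (hcauchy x hx)
  choose! U hU using hconv
  refine ⟨φ, U, hφ, ?_⟩
  -- locally uniform convergence
  rw [Metric.tendstoLocallyUniformlyOn_iff]
  intro ε hε x hx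
  obtain ⟨K, V, hV, hK'⟩ := hlip x hx
  obtain ⟨I, hI⟩ := eventually_atTop.1 hK'
  have hK : ∀ n, I ≤ n → LipschitzOnWith K (u (φ n)) V := fun n hn ↦
    hI (φ n) (hn.trans (hφ.id_le n))
  have hxV : x ∈ V := mem_of_mem_nhds hV
  have hUK : LipschitzOnWith K U (V ∩ Ω) :=
    lipschitzOnWith_of_tendsto (eventually_atTop.2 ⟨I, fun n hn ↦ (hK n hn).mono inter_subset_left⟩)
      fun y hy ↦ hU y hy.2
  set η : ℝ := ε / (4 * (K + 1)) with hη
  have hη0 : 0 < η := by positivity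
  have hKη : (K : ℝ) * η ≤ ε / 4 := by
    rw [hη, mul_div_assoc', div_le_div_iff₀ (by positivity) (by positivity)]
    nlinarith [NNReal.coe_nonneg K, hε.le]
  refine ⟨V ∩ Ω ∩ Metric.eball x (ENNReal.ofReal η), mem_nhdsWithin_of_mem_nhds
    (inter_mem (inter_mem hV (hΩ.mem_nhds hx)) (Metric.eball_mem_nhds x (by simpa using hη0))), ?_⟩
  obtain ⟨N, hN⟩ := (Metric.tendsto_atTop.1 (hU x hx)) (ε / 2) (half_pos hε)
  filter_upwards [eventually_ge_atTop N, eventually_ge_atTop I] with n hn hnI y hy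
  obtain ⟨⟨hyV, hyΩ⟩, hyball⟩ := hy
  have hxy : edist x y ≤ ENNReal.ofReal η := by
    rw [edist_comm]; exact (Metric.mem_eball.1 hyball).le
  have h1 : |U x - U y| ≤ K * η :=
    abs_sub_le_of_lipschitzOnWith hUK ⟨hxV, hx⟩ ⟨hyV, hyΩ⟩ hη0.le hxy
  have h2 : |u (φ n) x - u (φ n) y| ≤ K * η :=
    abs_sub_le_of_lipschitzOnWith (hK n hnI) hxV hyV hη0.le hxy
  have h3 : |u (φ n) x - U x| < ε / 2 := by
    have := hN n hn; rwa [Real.dist_eq] at this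
  rw [Real.dist_eq]
  calc |U y - u (φ n) y| ≤ |U y - U x| + |U x - u (φ n) x| + |u (φ n) x - u (φ n) y| := by
        calc |U y - u (φ n) y| ≤ |U y - u (φ n) x| + |u (φ n) x - u (φ n) y| := abs_sub_le _ _ _
          _ ≤ |U y - U x| + |U x - u (φ n) x| + |u (φ n) x - u (φ n) y| := by
              gcongr; exact abs_sub_le _ _ _
    _ < ε := by rw [abs_sub_comm (U y) (U x), abs_sub_comm (U x) (u (φ n) x)]; linarith


/-! ### The limit `L → ∞` -/

variable [MeasurableSpace X] [BorelSpace X] [ConnectedSpace X] [NoncompactSpace X]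
  [(ofRiemannian h).HasLeviCivita]

set_option backward.isDefEq.respectTransparency false in
/-- **The exterior solution from regularised Dirichlet solutions** (Huisken–Ilmanen 2001, proof of
Thm. 3.1, steps 1–2, with Lemmas 3.4–3.5 as input and interior comparison in place of the conic
modification). Let `E₀` be open, `v` a proper weak subsolution of (††) with precompact initial
condition `F₀ ⊇ Ē₀`, `U_L` an increasing exhaustion of `X` by open sets containing `Ē₀`, and
`w_{L,k} ∈ C²(X)` classical solutions of (⋆)_{ε_{L,k}} on `U_L ∖ Ē₀` (`ε_{L,k} > 0`,
`ε_{L,k} → 0` as `k → ∞`) satisfying: local gradient bounds uniform in `k` on `U_L ∖ Ē₀`, and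
uniform in `(L, k)` for `L` large near every point of `X ∖ Ē₀`; uniform Lipschitz bounds near
`∂E₀` on relative neighbourhoods in `X ∖ E₀`, and `w_{L,k} = 0` on `∂E₀`; `w_{L,k} ≥ −η_{L,k}` on
`U_L ∖ E₀` with `η_{L,k} → 0`; pointwise upper bounds uniform in `(L, k)`; and the lower barrier
`w_{L,k} ≥ b_L − δ` off a compact subset of `U_L` for every `δ > 0`, where `b_L → ∞`. Then there
is `u₀ : X → ℝ`, locally Lipschitz on `X ∖ E₀`, `u₀ = 0` on `∂E₀`, `u₀ ≥ 0` on `X ∖ E₀`, with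
compact `{x ∈ X ∖ E₀ | u₀ x ≤ t}` for all `t`, solving (1.5) on `X ∖ Ē₀` — the hypothesis of
`weak_existence_of_exterior_existence`.
[cite: HuiskenIlmanenIMCF2001, §3 proof of Thm. 3.1 (steps 1–2, "Passing L → ∞")] -/
theorem exterior_existence_of_regularised_dirichlet_solutions {E₀ F₀ : Set X} (hE₀ : IsOpen E₀)
    {v : X → ℝ} (hv : IsWeakSubsolutionIVP h v F₀) (hvp : IsProperFun v)
    (hF₀ : IsCompact (closure F₀)) (hE₀F₀ : closure E₀ ⊆ F₀)
    {U : ℕ → Set X} (hUo : ∀ L, IsOpen (U L)) (hE₀U : ∀ L, closure E₀ ⊆ U L)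
    (hUmono : ∀ L M : ℕ, L ≤ M → U L ⊆ U M) (hexh : ∀ K : Set X, IsCompact K → ∃ L, K ⊆ U L)
    {w : ℕ → ℕ → X → ℝ} {ε : ℕ → ℕ → ℝ} {ψ : ℕ → ℕ → X → ℝ} {η : ℕ → ℕ → ℝ} {b : ℕ → ℝ}
    (hb : Tendsto b atTop atTop)
    (hw : ∀ L k, ContMDiff (𝓡 3) 𝓘(ℝ, ℝ) 2 (w L k)) (hε : ∀ L k, 0 < ε L k)
    (hε0 : ∀ L, Tendsto (ε L) atTop (𝓝 0))
    (hψ : ∀ L k x, ψ L k x = Real.sqrt (gradNorm h (w L k) x ^ 2 + ε L k ^ 2))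
    (hψ1 : ∀ L k, ContMDiffOn (𝓡 3) 𝓘(ℝ, ℝ) 1 (ψ L k) (U L \ closure E₀))
    (hpde : ∀ L k, ∀ x ∈ U L \ closure E₀, ψ L k x * (ofRiemannian h).dalembertian (w L k) x -
      (ofRiemannian h).innerDual x (mvfderiv (𝓡 3) (ψ L k) x).toLinearMap
        (mvfderiv (𝓡 3) (w L k) x).toLinearMap = ψ L k x ^ 3)
    (hgradL : ∀ L, ∀ x ∈ U L \ closure E₀, ∃ C : ℝ≥0, ∃ V ∈ 𝓝 x, ∀ k, ∀ q ∈ V,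
      gradNorm h (w L k) q ≤ C)
    (hgrad : ∀ x, x ∉ closure E₀ → ∃ C : ℝ≥0, ∃ V ∈ 𝓝 x, ∃ L₀ : ℕ, ∀ L, L₀ ≤ L → ∀ k, ∀ q ∈ V,
      gradNorm h (w L k) q ≤ C)
    (hblip : letI : RiemannianBundle (fun x : X ↦ TangentSpace (𝓡 3) x) :=
        ⟨h.toContinuousRiemannianMetric.toRiemannianMetric⟩
      letI : PseudoEMetricSpace X := .ofRiemannianMetric (𝓡 3) X
      ∀ x ∈ frontier E₀, ∃ K : ℝ≥0, ∃ V ∈ 𝓝 x, ∀ L k, LipschitzOnWith K (w L k) (V ∩ E₀ᶜ))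
    (hzero : ∀ L k, ∀ x ∈ frontier E₀, w L k x = 0)
    (hη : ∀ L, Tendsto (η L) atTop (𝓝 0)) (hlow : ∀ L k, ∀ x ∈ U L, x ∉ E₀ → -η L k ≤ w L k x)
    (hup : ∀ x, x ∉ E₀ → ∃ B : ℝ, ∀ L k, x ∈ U L → w L k x ≤ B)
    (hbar : ∀ L, ∀ δ : ℝ, 0 < δ → ∃ C : Set X, IsCompact C ∧ C ⊆ U L ∧
      ∀ k, ∀ x ∈ U L, x ∉ C → b L - δ ≤ w L k x) :
    ∃ u₀ : X → ℝ, IsLocLipschitzOn h u₀ E₀ᶜ ∧ (∀ x ∈ frontier E₀, u₀ x = 0) ∧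
      (∀ x ∈ E₀ᶜ, 0 ≤ u₀ x) ∧ (∀ t : ℝ, IsCompact {x | x ∈ E₀ᶜ ∧ u₀ x ≤ t}) ∧
      IsWeakSolution h u₀ (closure E₀)ᶜ := by
  classical
  letI : RiemannianBundle (fun x : X ↦ TangentSpace (𝓡 3) x) :=
    ⟨h.toContinuousRiemannianMetric.toRiemannianMetric⟩
  letI : PseudoEMetricSpace X := .ofRiemannianMetric (𝓡 3) X
  set Ωi : Set X := (closure E₀)ᶜ with hΩidef
  have hΩio : IsOpen Ωi := isClosed_closure.isOpen_compl
  have hfront : frontier E₀ = closure E₀ \ E₀ := by rw [frontier, hE₀.interior_eq]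
  have hfrontE : ∀ x ∈ frontier E₀, x ∉ E₀ := fun x hx ↦ (hfront ▸ hx).2
  have hdecomp : ∀ x, x ∉ E₀ → x ∈ Ωi ∨ x ∈ frontier E₀ := fun x hxE ↦ by
    by_cases hxc : x ∈ closure E₀
    · exact Or.inr (hfront ▸ ⟨hxc, hxE⟩)
    · exact Or.inl hxc
  have hΩiE : Ωi ⊆ E₀ᶜ := fun x hx hxE ↦ hx (subset_closure hxE)
  have hvc : Continuous v := hv.continuous h
  have hF₀eq : F₀ = {x | v x < 0} := hv.2.1
  -- (1) the fixed-`L` limits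
  have part1 : ∀ L, ∃ (u : X → ℝ) (φ : ℕ → ℕ), StrictMono φ ∧
      TendstoLocallyUniformlyOn (fun n ↦ w L (φ n)) u atTop (U L ∩ E₀ᶜ) ∧
      IsWeakSolution h u (U L \ closure E₀) ∧ (∀ x ∈ frontier E₀, u x = 0) ∧
      (∀ x ∈ U L, x ∉ E₀ → 0 ≤ u x) ∧ ∀ x ∈ U L \ closure E₀, min (v x) (b L) ≤ u x := by
    intro L
    refine exists_isWeakSolution_ge_of_regularised_dirichlet h hE₀ (hUo L) (hE₀U L) hv hE₀F₀
      (hw L) (hε L) (hε0 L) (hψ L) (hψ1 L) (hpde L) (hgradL L) ?_ (hzero L) (hη L) (hlow L)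
      (fun x hxU hxE ↦ ?_) (hbar L)
    · intro x hx
      obtain ⟨K, V, hV, hK⟩ := hblip x hx
      exact ⟨K, V, hV, fun k ↦ hK L k⟩
    · obtain ⟨B, hB⟩ := hup x hxE
      exact ⟨B, fun k ↦ hB L k hxU⟩
  choose uL φL hφL hconvL hsolL hzeroL hnnL hgeL using part1
  -- (2) truncate to `0` off `U L`
  set uh : ℕ → X → ℝ := fun L x ↦ if x ∈ U L then uL L x else 0 with huh
  have huhU : ∀ L, ∀ x ∈ U L, uh L x = uL L x := fun L x hx ↦ by simp only [huh, if_pos hx]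
  have hsol' : ∀ L, IsWeakSolution h (uh L) (U L \ closure E₀) := fun L ↦
    (hsolL L).congr h ((hUo L).sdiff isClosed_closure) fun x hx ↦ (huhU L x hx.1).symm
  have hconv' : ∀ L, TendstoLocallyUniformlyOn (fun n ↦ w L (φL L n)) (uh L) atTop (U L ∩ E₀ᶜ) :=
    fun L ↦ (hconvL L).congr_right fun x hx ↦ (huhU L x hx.1).symm
  have hpt' : ∀ L, ∀ x ∈ U L ∩ E₀ᶜ, Tendsto (fun n ↦ w L (φL L n) x) atTop (𝓝 (uh L x)) :=
    fun L x hx ↦ (hconv' L).tendsto_at hx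
  have hzero' : ∀ L, ∀ x ∈ frontier E₀, uh L x = 0 := fun L x hx ↦ by
    rw [huhU L x (hE₀U L (frontier_subset_closure hx))]; exact hzeroL L x hx
  have hnn' : ∀ L x, x ∉ E₀ → 0 ≤ uh L x := fun L x hxE ↦ by
    by_cases hxU : x ∈ U L
    · rw [huhU L x hxU]; exact hnnL L x hxU hxE
    · simp only [huh, if_neg hxU]; exact le_rfl
  have hup' : ∀ x, x ∉ E₀ → ∃ B : ℝ, 0 ≤ B ∧ ∀ L, uh L x ≤ B := by
    intro x hxE
    obtain ⟨B, hB⟩ := hup x hxE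
    refine ⟨max B 0, le_max_right _ _, fun L ↦ ?_⟩
    by_cases hxU : x ∈ U L
    · exact (le_of_tendsto' (hpt' L x ⟨hxU, hxE⟩) fun n ↦ hB L _ hxU).trans (le_max_left _ _)
    · simp only [huh, if_neg hxU]; exact le_max_right _ _
  -- (3) equi-Lipschitz bounds for `(uh L)`, eventually in `L`, near the points of `Ωi`
  have hlipΩ : ∀ x ∈ Ωi, ∃ K : ℝ≥0, ∃ W ∈ 𝓝 x, W ⊆ Ωi ∧
      ∀ᶠ L in atTop, LipschitzOnWith K (uh L) W := by
    intro x hx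
    obtain ⟨C, V, hV, L₀, hC⟩ := hgrad x hx
    obtain ⟨N, hN, hNx⟩ := exists_compact_mem_nhds x
    obtain ⟨L₁, hL₁⟩ := hexh N hN
    obtain ⟨W, hW, hWV, c, hc⟩ := exists_nhds_subset_forall_lipschitzOnWith_of_gradNorm_le h x
      (inter_mem (inter_mem hV (hΩio.mem_nhds hx)) (interior_mem_nhds.2 hNx))
    refine ⟨C * c, W, hW, fun y hy ↦ (hWV hy).1.2, ?_⟩
    filter_upwards [eventually_ge_atTop (max L₀ L₁)] with L hL
    have hWU : W ⊆ U L := fun y hy ↦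
      hUmono L₁ L (le_of_max_le_right hL) (hL₁ (interior_subset (hWV hy).2))
    have hwk : ∀ k, LipschitzOnWith (C * c) (w L k) W := fun k ↦
      hc (w L k) C (fun q _ ↦ ((hw L k).of_le (by norm_num)).mdifferentiableAt one_ne_zero)
        fun q hq ↦ hC L (le_of_max_le_left hL) k q (hWV hq).1.1
    exact lipschitzOnWith_of_tendsto (Eventually.of_forall fun n ↦ hwk (φL L n))
      fun y hy ↦ hpt' L y ⟨hWU hy, hΩiE (hWV hy).1.2⟩
  -- (4) equi-Lipschitz bounds near `∂E₀`, eventually in `L`, on relative neighbourhoods in `E₀ᶜ`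
  have hlipB : ∀ x ∈ frontier E₀, ∃ K : ℝ≥0, ∃ W ∈ 𝓝 x,
      ∀ᶠ L in atTop, LipschitzOnWith K (uh L) (W ∩ E₀ᶜ) := by
    intro x hx
    obtain ⟨K, V, hV, hK⟩ := hblip x hx
    obtain ⟨N, hN, hNx⟩ := exists_compact_mem_nhds x
    obtain ⟨L₁, hL₁⟩ := hexh N hN
    refine ⟨K, V ∩ interior N, inter_mem hV (interior_mem_nhds.2 hNx), ?_⟩
    filter_upwards [eventually_ge_atTop L₁] with L hL
    have hWU : V ∩ interior N ⊆ U L := fun y hy ↦ hUmono L₁ L hL (hL₁ (interior_subset hy.2))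
    exact lipschitzOnWith_of_tendsto
      (Eventually.of_forall fun n ↦ (hK L (φL L n)).mono fun y hy ↦ ⟨hy.1.1, hy.2⟩)
      fun y hy ↦ hpt' L y ⟨hWU hy.1, hy.2⟩
  -- (5) Arzelà–Ascoli over `L` on `Ωi`
  obtain ⟨Λ, u₁, hΛ, hconvΩ⟩ :=
    exists_strictMono_tendstoLocallyUniformlyOn_of_eventually_lipschitzOnWith h hΩio
      (fun x hx ↦ by
        obtain ⟨K, W, hW, -, hK⟩ := hlipΩ x hx
        exact ⟨K, W, hW, hK⟩)
      (fun x hx ↦ by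
        obtain ⟨B, hB0, hB⟩ := hup' x (hΩiE hx)
        exact ⟨B, fun L ↦ abs_le.2 ⟨by linarith [hnn' L x (hΩiE hx)], hB L⟩⟩)
  set u : X → ℝ := fun x ↦ if x ∈ Ωi then u₁ x else 0 with hudef
  have huΩ : ∀ x ∈ Ωi, u x = u₁ x := fun x hx ↦ by simp only [hudef, if_pos hx]
  have hu0 : ∀ x ∈ frontier E₀, u x = 0 := fun x hx ↦ by
    have : x ∉ Ωi := fun h' ↦ h' (frontier_subset_closure hx)
    simp only [hudef, if_neg this]
  have hconv : TendstoLocallyUniformlyOn (fun j ↦ uh (Λ j)) u atTop Ωi :=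
    hconvΩ.congr_right fun x hx ↦ (huΩ x hx).symm
  have hΛev : ∀ {p : ℕ → Prop}, (∀ᶠ L in atTop, p L) → ∀ᶠ j in atTop, p (Λ j) := fun hp ↦
    hΛ.tendsto_atTop.eventually hp
  have hpt : ∀ x, x ∉ E₀ → Tendsto (fun j ↦ uh (Λ j) x) atTop (𝓝 (u x)) := by
    intro x hxE
    rcases hdecomp x hxE with hxΩ | hxf
    · exact hconv.tendsto_at hxΩ
    · rw [hu0 x hxf]
      exact tendsto_const_nhds.congr fun j ↦ (hzero' (Λ j) x hxf).symm
  -- (6) the Compactness Theorem 2.1 along `L = Λ j → ∞`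
  have hsol : IsWeakSolution h u Ωi := by
    refine isWeakSolution_of_tendstoLocallyUniformlyOn h hΩio
      (fun j ↦ (hUo (Λ j)).sdiff isClosed_closure) (fun j ↦ hsol' (Λ j)) (fun K hK hKΩ ↦ ?_)
      hconv fun x hx ↦ ?_
    · obtain ⟨L₂, hL₂⟩ := hexh K hK
      filter_upwards [eventually_ge_atTop L₂] with j hj
      exact fun y hy ↦ ⟨hUmono L₂ (Λ j) (hj.trans (hΛ.id_le j)) (hL₂ hy), hKΩ hy⟩
    · obtain ⟨K, W, hW, -, hK⟩ := hlipΩ x hx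
      exact ⟨K, W, hW, hΛev hK⟩
  -- (7) the properties of the exterior solution
  have hnonneg : ∀ x ∈ E₀ᶜ, 0 ≤ u x := fun x hxE ↦
    ge_of_tendsto' (hpt x hxE) fun j ↦ hnn' (Λ j) x hxE
  have hge : ∀ x ∈ E₀ᶜ, v x ≤ u x := by
    intro x hxE
    rcases hdecomp x hxE with hxΩ | hxf
    · obtain ⟨L₁, hL₁⟩ := hexh {x} isCompact_singleton
      have hev : ∀ᶠ L in atTop, v x ≤ uh L x := by
        filter_upwards [eventually_ge_atTop L₁, hb.eventually_ge_atTop (v x)] with L hL hbL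
        have hxU : x ∈ U L := hUmono L₁ L hL (hL₁ rfl)
        rw [huhU L x hxU]
        have := hgeL L x ⟨hxU, hxΩ⟩
        rwa [min_eq_left hbL] at this
      exact ge_of_tendsto (hpt x hxE) (hΛev hev)
    · have hxF : x ∈ F₀ := hE₀F₀ (frontier_subset_closure hxf)
      rw [hF₀eq] at hxF
      rw [hu0 x hxf]
      exact le_of_lt hxF
  have hlip : IsLocLipschitzOn h u E₀ᶜ := by
    intro x hxE
    rcases hdecomp x hxE with hxΩ | hxf
    · obtain ⟨K, W, hW, hWΩ, hK⟩ := hlipΩ x hxΩ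
      refine ⟨K, W, mem_nhdsWithin_of_mem_nhds hW, ?_⟩
      exact lipschitzOnWith_of_tendsto (hΛev hK) fun y hy ↦ hpt y (hΩiE (hWΩ hy))
    · obtain ⟨K, W, hW, hK⟩ := hlipB x hxf
      refine ⟨K, E₀ᶜ ∩ W, inter_mem_nhdsWithin _ hW, ?_⟩
      refine lipschitzOnWith_of_tendsto (f := fun j ↦ uh (Λ j)) ?_ fun y hy ↦ hpt y hy.1
      filter_upwards [hΛev hK] with j hj
      exact hj.mono fun y hy ↦ ⟨hy.2, hy.1⟩
  have hcont : ContinuousOn u E₀ᶜ := hlip.continuousOn h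
  refine ⟨u, hlip, hu0, hnonneg, fun t ↦ ?_, hsol⟩
  exact isCompact_sep_le_of_le hE₀.isClosed_compl hvp (hF₀eq ▸ hF₀) hcont hge t

/-! ### The named fact from the PDE package -/

/-- **`weak_existence` from the elliptic regularisation.** The named fact `weak_existence`
(Huisken–Ilmanen 2001, Thm. 3.1 for `n = 3`) follows once, for every datum of the fact and every
normalised subsolution `v` (`Ē₀ ⊆ F₀`), the *analytic package* of Lemmas 3.4–3.5 is available: an
increasing exhaustion `U_L ⊇ Ē₀` of `X` by open sets and classical solutions `w_{L,k} ∈ C²(X)` of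
the regularised equations (⋆)_{ε_{L,k}} on `U_L ∖ Ē₀`, `ε_{L,k} → 0`, with the interior gradient
estimates, the boundary Lipschitz estimates and zero boundary values at `∂E₀`, the lower bounds
`w ≥ −η_{L,k} → 0`, pointwise upper bounds, and the lower barrier `b_L − δ` at the outer boundary,
`b_L → ∞` — exactly the hypotheses of `exterior_existence_of_regularised_dirichlet_solutions`.
(Normalisation of `v`: `exists_isWeakSubsolutionIVP_closure_subset`; then
`exterior_existence_of_regularised_dirichlet_solutions` and `weak_existence_of_exterior_existence`.)
This isolates the only ingredient of the printed proof that is not formalized here: the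
Hölder-space theory of the Dirichlet problem for (⋆)_ε (loc. cit., Lemmas 3.4–3.5).
[cite: HuiskenIlmanenIMCF2001, Thm. 3.1, Lemmas 3.4–3.5] -/
theorem weak_existence_of_regularised_dirichlet_solutions
    (H : ∀ (X : Type) [TopologicalSpace X] [ChartedSpace E3 X] [IsManifold (𝓡 3) ∞ X]
      [T2Space X] [SecondCountableTopology X] [LocallyCompactSpace X] [ConnectedSpace X]
      [NoncompactSpace X] [MeasurableSpace X] [BorelSpace X]
      (h : ContMDiffRiemannianMetric (𝓡 3) ∞ E3 (TangentSpace (𝓡 3) : X → Type _))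
      [(ofRiemannian h).HasLeviCivita],
      IsGeodesicallyComplete (ofRiemannian h).leviCivita →
      ∀ (E₀ F₀ : Set X) (v : X → ℝ), E₀.Nonempty → IsSmoothPrecompactOpen E₀ →
        IsWeakSubsolutionIVP h v F₀ → IsProperFun v → IsCompact (closure F₀) → closure E₀ ⊆ F₀ →
        ∃ (U : ℕ → Set X) (w : ℕ → ℕ → X → ℝ) (ε : ℕ → ℕ → ℝ) (ψ : ℕ → ℕ → X → ℝ)
          (η : ℕ → ℕ → ℝ) (b : ℕ → ℝ),
          (∀ L, IsOpen (U L)) ∧ (∀ L, closure E₀ ⊆ U L) ∧ (∀ L M : ℕ, L ≤ M → U L ⊆ U M) ∧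
          (∀ K : Set X, IsCompact K → ∃ L, K ⊆ U L) ∧ Tendsto b atTop atTop ∧
          (∀ L k, ContMDiff (𝓡 3) 𝓘(ℝ, ℝ) 2 (w L k)) ∧ (∀ L k, 0 < ε L k) ∧
          (∀ L, Tendsto (ε L) atTop (𝓝 0)) ∧
          (∀ L k x, ψ L k x = Real.sqrt (gradNorm h (w L k) x ^ 2 + ε L k ^ 2)) ∧
          (∀ L k, ContMDiffOn (𝓡 3) 𝓘(ℝ, ℝ) 1 (ψ L k) (U L \ closure E₀)) ∧
          (∀ L k, ∀ x ∈ U L \ closure E₀, ψ L k x * (ofRiemannian h).dalembertian (w L k) x -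
            (ofRiemannian h).innerDual x (mvfderiv (𝓡 3) (ψ L k) x).toLinearMap
              (mvfderiv (𝓡 3) (w L k) x).toLinearMap = ψ L k x ^ 3) ∧
          (∀ L, ∀ x ∈ U L \ closure E₀, ∃ C : ℝ≥0, ∃ V ∈ 𝓝 x, ∀ k, ∀ q ∈ V,
            gradNorm h (w L k) q ≤ C) ∧
          (∀ x, x ∉ closure E₀ → ∃ C : ℝ≥0, ∃ V ∈ 𝓝 x, ∃ L₀ : ℕ, ∀ L, L₀ ≤ L → ∀ k, ∀ q ∈ V,
            gradNorm h (w L k) q ≤ C) ∧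
          (letI : RiemannianBundle (fun x : X ↦ TangentSpace (𝓡 3) x) :=
              ⟨h.toContinuousRiemannianMetric.toRiemannianMetric⟩;
            letI : PseudoEMetricSpace X := .ofRiemannianMetric (𝓡 3) X;
            ∀ x ∈ frontier E₀, ∃ K : ℝ≥0, ∃ V ∈ 𝓝 x, ∀ L k,
              LipschitzOnWith K (w L k) (V ∩ E₀ᶜ)) ∧
          (∀ L k, ∀ x ∈ frontier E₀, w L k x = 0) ∧
          (∀ L, Tendsto (η L) atTop (𝓝 0)) ∧ (∀ L k, ∀ x ∈ U L, x ∉ E₀ → -η L k ≤ w L k x) ∧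
          (∀ x, x ∉ E₀ → ∃ B : ℝ, ∀ L k, x ∈ U L → w L k x ≤ B) ∧
          (∀ L, ∀ δ : ℝ, 0 < δ → ∃ C : Set X, IsCompact C ∧ C ⊆ U L ∧
            ∀ k, ∀ x ∈ U L, x ∉ C → b L - δ ≤ w L k x)) :
    weak_existence := by
  refine weak_existence_of_exterior_existence fun X _ _ _ _ _ _ _ _ _ _ h _ hcomplete hsub E₀ hne hE₀ ↦ ?_
  obtain ⟨v, F₀, hvp, hF₀, hv, hE₀F₀⟩ := exists_isWeakSubsolutionIVP_closure_subset h hsub hE₀.2.1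
  obtain ⟨U, w, ε, ψ, η, b, hUo, hE₀U, hUmono, hexh, hb, hw, hε, hε0, hψ, hψ1, hpde, hgradL, hgrad,
    hblip, hzero, hη, hlow, hup, hbar⟩ := H X h hcomplete E₀ F₀ v hne hE₀ hv hvp hF₀ hE₀F₀
  exact exterior_existence_of_regularised_dirichlet_solutions h hE₀.1 hv hvp hF₀ hE₀F₀ hUo hE₀U
    hUmono hexh hb hw hε hε0 hψ hψ1 hpde hgradL hgrad hblip hzero hη hlow hup hbar

end Literature.Geometry.Lorentzian

end
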